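import Summits.CriticalPhenomena.PercolationContinuityZ3.Theorems.PercNearOneGluingNoHeavyLowerTailAntitheticSourcePendant
import Summits.CriticalPhenomena.PercolationContinuityZ3.Theorems.PercNearOneGluingNoHeavyLowerTailAntitheticDomTopAll
import HarnessLib

/-!
# `NoHeavyLowerTail` (stmt-CriticalPhenomena-4575) — antithetic cluster pairs: **THEOREM TWD WITH A PENDANT PRIVATE NEIGHBOUR OF THE
# SOURCE** (prim-hp-2 gen 75, HOME/THEOREM-PRIV.md §2 — the degenerate case of CONJECTURE P1)

Support file (`--supports stmt-CriticalPhenomena-4575`, prim-hp-2 gen 75).  No definitions, no named facts, no sorries; standard axioms.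
`s ≠ P`, `sP ∉ E`, every neighbour of `s` in `E` adjacent to `P` (THEOREM TWD, …AntitheticDomTopAll), and `a ∉ {s, P}` a vertex meeting no
pair of `E`.  In the graph `E ∪ {sa}` the source has exactly one PRIVATE neighbour, the pendant vertex `a`, and CONJECTURE P1 holds there:
* `Antithetic.DomPendant.top_sum_nonneg` — the top event of `(E ∪ {sa}, s, P)` is nonnegative in `K`-form (THEOREM TWD transported through the
  pendant edge by `SourcePendant.top_sum_nonneg_insert`);
* `Antithetic.DomPendant.top_shift_sum_nonneg`, `Antithetic.DomPendant.vertex_sum_nonneg` — TOP_shift and the |R| = 1 VERTEX ANTITHETIC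
  INEQUALITY at `P` for `E ∪ {sa}`.  (Iterate for several pendant hairs at `s`.)
[cite: VandenbergHaggstromKahn2005, §1 p. 6 ("Harris' inequality"), §1 p. 3 (open cluster `C_s`)]
-/

noncomputable section

namespace Summit.CriticalPhenomena.PercolationContinuityZ3.Theorems

open Literature.Probability.Percolation
open scoped Classical

namespace Antithetic

namespace DomPendant

variable {V : Type*} [Fintype V]

/-- **THEOREM TWD + a pendant private neighbour (`K`-form).**  `s ≠ P`, `sP ∉ E`, `N_E(s) ⊆ N_E(P)`, `a ∉ {s,P}` isolated in `E`.  Then the top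
event of `P` in `E ∪ {sa}` is nonnegative for all super-odd twisted-monotone `K₁, K₂`. [this work] -/
theorem top_sum_nonneg (E : Set (Sym2 V)) (s P a : V) (hsP : s ≠ P) (hsPE : s(s, P) ∉ E)
    (hdom : ∀ v, v ≠ s → v ≠ P → s(s, v) ∈ E → s(P, v) ∈ E) (haE : ∀ e ∈ E, a ∉ e) (hsa : s ≠ a) (hPa : P ≠ a)
    {K₁ K₂ : Set V → Set V → ℝ}
    (hK₁ : ∀ ⦃A A' B B' : Set V⦄, A ⊆ A' → B' ⊆ B → K₁ A B ≤ K₁ A' B') (hso₁ : ∀ A B, 0 ≤ K₁ A B + K₁ B A)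
    (hK₂ : ∀ ⦃A A' B B' : Set V⦄, A ⊆ A' → B' ⊆ B → K₂ A B ≤ K₂ A' B') (hso₂ : ∀ A B, 0 ≤ K₂ A B + K₂ B A) :
    0 ≤ ∑ T ∈ Finset.univ.filter (fun T : Set (Sym2 V) =>
        P ∈ openCluster (T ∩ insert s(s, a) E) s ∧ P ∉ openCluster (Tᶜ ∩ insert s(s, a) E) s),
      K₁ (openCluster (T ∩ insert s(s, a) E) s) (openCluster (Tᶜ ∩ insert s(s, a) E) s) *
        K₂ (openCluster (T ∩ insert s(s, a) E) s) (openCluster (Tᶜ ∩ insert s(s, a) E) s) :=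
  SourcePendant.top_sum_nonneg_insert E s P a haE hsa hPa
    (fun _ _ hL₁ hsoL₁ hL₂ hsoL₂ => Dom.top_sum_nonneg_dom E s P hsP hsPE hdom hL₁ hsoL₁ hL₂ hsoL₂) hK₁ hso₁ hK₂ hso₂

/-- **THEOREM TWD + a pendant private neighbour (shifted top form).** [this work] -/
theorem top_shift_sum_nonneg (E : Set (Sym2 V)) (s P a : V) (hsP : s ≠ P) (hsPE : s(s, P) ∉ E)
    (hdom : ∀ v, v ≠ s → v ≠ P → s(s, v) ∈ E → s(P, v) ∈ E) (haE : ∀ e ∈ E, a ∉ e) (hsa : s ≠ a) (hPa : P ≠ a)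
    (Fp Fm Gp Gm : Set V → ℝ) (hFp : Monotone Fp) (hFm : Monotone Fm) (hF : ∀ S, Fm S ≤ Fp S)
    (hGp : Monotone Gp) (hGm : Monotone Gm) (hG : ∀ S, Gm S ≤ Gp S) :
    0 ≤ ∑ T ∈ Finset.univ.filter (fun T : Set (Sym2 V) =>
        P ∈ openCluster (T ∩ insert s(s, a) E) s ∧ P ∉ openCluster (Tᶜ ∩ insert s(s, a) E) s),
      (Fp (openCluster (T ∩ insert s(s, a) E) s) - Fm (openCluster (Tᶜ ∩ insert s(s, a) E) s)) *
        (Gp (openCluster (T ∩ insert s(s, a) E) s) - Gm (openCluster (Tᶜ ∩ insert s(s, a) E) s)) := by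
  have hK₁ : ∀ ⦃A A' B B' : Set V⦄, A ⊆ A' → B' ⊆ B → Fp A - Fm B ≤ Fp A' - Fm B' :=
    fun A A' B B' hA hB => sub_le_sub (hFp hA) (hFm hB)
  have hK₂ : ∀ ⦃A A' B B' : Set V⦄, A ⊆ A' → B' ⊆ B → Gp A - Gm B ≤ Gp A' - Gm B' :=
    fun A A' B B' hA hB => sub_le_sub (hGp hA) (hGm hB)
  have hso₁ : ∀ A B : Set V, 0 ≤ (Fp A - Fm B) + (Fp B - Fm A) := fun A B => by linarith [hF A, hF B]
  have hso₂ : ∀ A B : Set V, 0 ≤ (Gp A - Gm B) + (Gp B - Gm A) := fun A B => by linarith [hG A, hG B]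
  exact top_sum_nonneg E s P a hsP hsPE hdom haE hsa hPa (K₁ := fun A B => Fp A - Fm B) (K₂ := fun A B => Gp A - Gm B) hK₁ hso₁ hK₂ hso₂

/-- **The |R| = 1 vertex antithetic inequality at `P` for THEOREM TWD's graph plus a pendant private neighbour of the source.**  For all
monotone `F, G`: `0 ≤ Σ_{T : ¬(P ∈ X T ∧ P ∈ Y T)} (F(X T) − F(Y T))·(G(X T) − G(Y T))` in `E ∪ {sa}`. [this work] -/
theorem vertex_sum_nonneg (E : Set (Sym2 V)) (s P a : V) (hsP : s ≠ P) (hsPE : s(s, P) ∉ E)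
    (hdom : ∀ v, v ≠ s → v ≠ P → s(s, v) ∈ E → s(P, v) ∈ E) (haE : ∀ e ∈ E, a ∉ e) (hsa : s ≠ a) (hPa : P ≠ a)
    {F G : Set V → ℝ} (hF : Monotone F) (hG : Monotone G) :
    0 ≤ ∑ T ∈ Finset.univ.filter (fun T : Set (Sym2 V) =>
        ¬ ((openGraph (T ∩ insert s(s, a) E)).Reachable s P ∧ (openGraph (Tᶜ ∩ insert s(s, a) E)).Reachable s P)),
      (F (openCluster (T ∩ insert s(s, a) E) s) - F (openCluster (Tᶜ ∩ insert s(s, a) E) s)) *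
        (G (openCluster (T ∩ insert s(s, a) E) s) - G (openCluster (Tᶜ ∩ insert s(s, a) E) s)) :=
  TopVertex.vertex_sum_nonneg_of_top (insert s(s, a) E) s P (fun F' G' hF' hG' =>
    top_shift_sum_nonneg E s P a hsP hsPE hdom haE hsa hPa F' F' G' G' hF' hF' (fun _ => le_rfl) hG' hG' (fun _ => le_rfl)) hF hG

end DomPendant

end Antithetic

end Summit.CriticalPhenomena.PercolationContinuityZ3.Theorems
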